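import Summits.Langlands.Langlands.Theses.RamifiedCoefficientSeed
import Literature.NumberTheory.GaloisRepresentations.FramedRepTwist

/-!
# Disproof of `AdjointSeedFromDuality` (crux stmt-Langlands-16780) — findings, cycle 1 (2026-08-17)

Crux (route `RamifiedCoefficientSeed`, rank 4, "the lever, typed residually"):
`∀ p ≥ 5, ∀ ρ : Γ_ℚ →ₜ* GL₃(ℚ̄_p)`, H1 (`∃ ν, ∀ σ, ‖tr ρ(σ) − ν(σ) tr ρ(σ⁻¹)‖ < 1`) → H2
(`ρ|Γ_{ℚ(ζ_p)}` residually absolutely irreducible) → H3 (some complex conjugation `c` has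
`tr ρ(c) = ±1`) → Concl (`∃ ρ₀ : Γ_ℚ →ₜ* GL₂(ℚ̄_p)` ODD, `∃ η`, `∀ σ,
‖tr ρ(σ) − η(σ)(tr ρ₀(σ)²/det ρ₀(σ) − 1)‖ < 1`).  `adjointSeedFromDuality_iff` below is `Iff.rfl`.

## VERDICT OF THIS CYCLE: the crux RESISTS — it is a theorem modulo Khare–Wintenberger.
Paper proof, checked line by line against the typed statement: traces are integral (compact image),
`ν` has unit-norm values (`norm_entry_eq_one` below), so H1 reduces to `tr ρ̄ = ν̄ · tr ρ̄^∨`; `p > 3`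
⇒ Newton ⇒ equal characteristic polynomials ⇒ Brauer–Nesbitt ⇒ `ρ̄ ≅ ρ̄^∨ ⊗ ν̄` (`ρ̄` abs. irreducible
by H2); Schur ⇒ the form is `ε`-symmetric, `ε = −1` impossible in odd rank ⇒ `ρ̄ : Γ_ℚ → GO₃`;
`GO₃ = 𝔾_m·SO₃` (`g = λ g′`, `λ = det g/ν(g)`), `SO₃(𝔽̄_p) = Ad(GL₂(𝔽̄_p))`, Tate (`H²(Γ_ℚ, 𝔽̄_pˣ) = 0`)
⇒ `ρ̄ ≅ λ̄ ⊗ ad⁰ τ̄`; at `c`: `τ̄` even ⇒ `τ̄(c) = ±1` ⇒ `tr ρ̄(c) = ±3 ≠ ±1` for `p ≥ 5`, so `τ̄` is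
ODD, and irreducible (a `τ̄`-stable line makes `ad⁰ τ̄` reducible); Khare–Wintenberger ⇒ `τ̄ ≅ ρ̄_g`,
`ρ₀ := ρ_g` (odd, continuous, exact reduction since `τ̄` is irreducible), `η :=` Teichmüller lift of
`λ̄`.  Formalisation-glitch hunt (all negative): the norm on `PadicAlgCl p` is the `p`-adic spectral
norm (so `‖x − y‖ < 1` IS `x ≡ y mod 𝔪` on integral elements); `FramedGaloisRep` is a CONTINUOUS hom
(no bare-hom loophole); `IsOdd` is `det ρ₀(c) = −1` for every `(φ, c)` (one `φ : ℚ →+* ℝ`, all `c`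
conjugate — consistent); `IsResiduallyAbsIrreducible` is a genuine lattice condition
(`IsReductionOf` + `IsAbsIrreducible` over all `k' : Type`, universe-consistent with
`padicAlgClResidueField p : Type`); `tr ρ(c) = ±1` EXACTLY is equivalent to the residual version for
an involution in characteristic `0` and `p ≥ 5` (`tr ρ(c) ∈ {±1, ±3}`).  The planner's recorded risk
"τ̄ odd but EVERY lift obstructed at p = 5, 7 with tiny image" is VOID: K–W supplies `ρ_g` for every
odd irreducible `τ̄` at every `p`, and for `p ∤ |im τ̄|` the Teichmüller/Serre-Prop-43 lift is even
fact-free (the lead's stub G records exactly this split).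

## KERNEL-CHECKED CONTENT (sorry-free; axioms `propext, Classical.choice, Quot.sound`)
* §3 `seedConcl_forces_parity` — Concl ⇒ EVERY complex conjugation has `tr ρ(c) ≡ ±1 (mod 𝔪)`
  (an odd involution in `GL₂` has trace `0`, `trace_eq_zero_of_mul_self_eq_one`; `η(c) = ±1`).
  So H3 is NECESSARY, not an artefact; no hypothesis on `p`.  `seedConcl_forces_parity_exact`:
  for odd `p` even VERBATIM (`tr ρ(c) = ±1` exactly: involutions in `GL₃` have trace `∈ {±1, ±3}`).
* §3 `seedConcl_forces_duality` — Concl ⇒ H1 with `ν = η²` (`ad⁰` is self-dual: `adTrace_inv`;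
  `‖η(σ)‖ = 1`: `norm_entry_eq_one`, from compactness of `Γ_ℚ`).  So H1 is NECESSARY; any proof of a
  duality-free variant is impossible.
* §4b `no_even_seed` — under H3 (and `p ≠ 2`) the VARIANT of the conclusion with an EVEN seed
  (`det ρ₀(c) = +1`) is refuted outright: an even involution has `tr²/det − 1 = 3`, `‖±1 ∓ 3‖ = 1`.
* §4 `withoutParity_false_of_evenWitness : EvenWitness → ¬ WithoutParity` and
  `withoutDuality_false_of_nonSelfDualWitness : NonSelfDualWitness → ¬ WithoutDuality` — the H3-less
  and H1-less cruxes die as soon as the obvious witnesses (even `S₄`-rotation / `ad⁰` of even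
  icosahedral; `PSL₂(𝔽₇)` Artin representation at `p ∤ 14·disc`) are constructed; the tree cannot
  construct non-abelian Galois images yet, so these are implications from precise `Prop`s.

## PAPER-ONLY FINDINGS (for the provers / the lead)
* H2 is STRONGER than this crux needs: only absolute irreducibility of `ρ̄` on `Γ_ℚ` is used (the
  `ℚ(ζ_p)` restriction is consumed downstream by `AdjointLiftingGL3`).  "Hypothesis possibly
  weakenable" — information, not a defect.
* H2 IS load-bearing, but only through reducible `ρ̄` of the shape `α ⊕ σ̄` with `σ̄` irreducible,
  PRIMITIVE (not induced from a quadratic field), `det σ̄ = α²`, `σ̄(c) = −α(c)·1`: sums of three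
  characters satisfying H1+H3 always have the residual adjoint shape `η(1 ⊕ ψ ⊕ ψ⁻¹)`, `ψ(c) = −1`,
  and satisfy Concl via Teichmüller lifts.  Smallest witness: `ρ = 1 ⊕ σ′` with
  `σ′ : Gal(L/ℚ) ≅ SL₂(𝔽₃) ↪ SL₂(ℚ̄_p)` the natural determinant-one representation of a normal CM field
  `L` of degree `24` — explicitly `L =` the splitting field of `x⁸ + 9x⁶ + 23x⁴ + 14x² + 1`
  (Lemmermeyer–Louboutin–Okazaki, JTNB 11 (1999), Thm. 18, doi:10.5802/jtnb.257: `Gal(L/ℚ) ≅ SL₂(𝔽₃)`,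
  `L` CM, read p. 404) — (then `c` is the central involution, `σ′(c) = −1`, `tr ρ(c) = −1`, `ρ ≅ ρ^∨`):
  Concl would force `ad⁰ ρ̄₀ ^ss ≅ η̄⁻¹(1 ⊕ σ̄′)`, i.e. `ρ̄₀` reducible or dihedral, i.e. `σ̄′` a sum of
  characters or induced — impossible for projective image `A₄`.  Not typed here (needs block sums +
  Brauer–Nesbitt + Clifford on the residual side; L-sized).
* `5 ≤ p` is probably weakenable to `p ≠ 2` (at `p = 3` Brauer–Nesbitt-by-traces in rank `3` still
  follows from linear independence of absolutely irreducible characters, and `±3 = 0 ≠ ±1`); `p = 2`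
  is genuinely degenerate (parity is vacuous mod `2`).  Not load-bearing for the route (`p ≥ 11`).
* No strengthening of Concl to a characteristic-`0` isomorphism `ρ ≅ η ⊗ ad⁰ ρ₀` is possible (the
  route's own members are NOT essentially self-dual) — the congruence form is the right one.

## -- Targets (lead's line `birth`, reshaped 2026-08-17 into stubs A–G; payload targets = ∅)
Cheap audit of each stub AS TYPED (details in the `Targets` section at the end of this file): all
seven are true (G conditionally on the named fact K–W / fact-free on the `p′`-branch).  Checked in
particular the `sl₂` conventions of stub C (`X_v = !![v 1, v 0; v 2, −v 1]`, Gram matrix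
`J = !![0,0,1;0,2,0;1,0,0]`: `tr(X_v X_w) = vᵀ J w`, `det J = −2 ≠ 0`, and `N := T⁻¹ M T ∈ SO(J)`
whenever `Tᵀ A T = J`, `Mᵀ A M = A`, `det M = 1`), the missing `5 ≤ p` in stub A (harmless: A holds
for every `p`), and the exact-lift bookkeeping of stub F (`p ≠ 2` suffices).  No stub kill; no
`stub_false` theorem below.

## WHY IT RESISTS (one line): H1 and H3 are forced by the conclusion, H2 makes `ρ̄` land in
`GO₃ = 𝔾_m·Ad(GL₂)` with an irreducible `τ̄`, parity makes `τ̄` odd, and Serre's conjecture is a theorem.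
-/

-- `Summit.Langlands.Langlands.…` repeats a namespace component by design (D-0017 nested layout).
set_option linter.dupNamespace false

noncomputable section

namespace Summit.Langlands.Langlands.Cruxes.AdjointSeedFromDuality.Disproof

open scoped MatrixGroups
open Summit.Langlands.Langlands.Theses.RamifiedCoefficientSeed
open Literature.NumberTheory.GaloisRepresentations

/-! ## 0. The crux, hypothesis by hypothesis -/

section Hyps

variable {p : ℕ} [Fact p.Prime]

/-- H1 (residual essential self-duality, trace form). [folklore] -/
def DualityHyp (ρ : FramedGaloisRep ℚ (PadicAlgCl p) 3) : Prop :=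
  ∃ ν : FramedGaloisRep ℚ (PadicAlgCl p) 1,
    ∀ σ, ‖(ρ σ).val.trace - (ν σ).val 0 0 * (ρ σ⁻¹).val.trace‖ < 1

/-- H2 (residual absolute irreducibility on `Γ_{ℚ(ζ_p)}`). [folklore] -/
def IrredHyp (ρ : FramedGaloisRep ℚ (PadicAlgCl p) 3) : Prop :=
  (ρ.restrictField (CyclotomicField p ℚ)).IsResiduallyAbsIrreducible

/-- H3 (a complex conjugation of trace `±1`). [folklore] -/
def ParityHyp (ρ : FramedGaloisRep ℚ (PadicAlgCl p) 3) : Prop :=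
  ∃ (φ : ℚ →+* ℝ) (c : Field.absoluteGaloisGroup ℚ), IsComplexConjugation φ c ∧
    ((ρ c).val.trace = 1 ∨ (ρ c).val.trace = -1)

/-- The conclusion (an odd characteristic-zero adjoint seed with the congruence). [folklore] -/
def SeedConcl (ρ : FramedGaloisRep ℚ (PadicAlgCl p) 3) : Prop :=
  ∃ (ρ₀ : FramedGaloisRep ℚ (PadicAlgCl p) 2) (η : FramedGaloisRep ℚ (PadicAlgCl p) 1),
    ρ₀.IsOdd ∧ ∀ σ, ‖(ρ σ).val.trace -
      (η σ).val 0 0 * ((ρ₀ σ).val.trace ^ 2 * ((ρ₀ σ).val.det)⁻¹ - 1)‖ < 1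

end Hyps

/-- The crux is literally `∀ p ≥ 5, ∀ ρ, H1 → H2 → H3 → Concl`. [folklore] -/
theorem adjointSeedFromDuality_iff :
    AdjointSeedFromDuality ↔ ∀ (p : ℕ) [Fact p.Prime], 5 ≤ p →
      ∀ ρ : FramedGaloisRep ℚ (PadicAlgCl p) 3,
        DualityHyp ρ → IrredHyp ρ → ParityHyp ρ → SeedConcl ρ :=
  Iff.rfl

/-! ## 1. Linear algebra in rank 2 -/

/-- An involution of determinant `-1` in `M₂(F)` has trace `0` (`(tr M)² = 0` from the diagonal
entries of `M² = 1` and `det M = -1`). [folklore] -/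
theorem trace_eq_zero_of_mul_self_eq_one {F : Type*} [Field F] {M : Matrix (Fin 2) (Fin 2) F}
    (hM : M * M = 1) (hdet : M.det = -1) : M.trace = 0 := by
  have h00 : (M * M) 0 0 = (1 : Matrix (Fin 2) (Fin 2) F) 0 0 := by rw [hM]
  have h11 : (M * M) 1 1 = (1 : Matrix (Fin 2) (Fin 2) F) 1 1 := by rw [hM]
  simp only [Matrix.mul_apply, Fin.sum_univ_two, Matrix.one_apply_eq] at h00 h11
  rw [Matrix.det_fin_two] at hdet
  rw [Matrix.trace_fin_two]
  have hsq : (M 0 0 + M 1 1) ^ 2 = 0 := by linear_combination h00 + h11 + 2 * hdet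
  exact (pow_eq_zero_iff two_ne_zero).mp hsq

/-- `tr(M⁻¹)²/det(M⁻¹) = tr(M)²/det M` in `GL₂(F)`: the adjoint trace `tr ad⁰ = tr²/det - 1` is
inversion invariant (`ad⁰` is self-dual). [folklore] -/
theorem adTrace_inv {F : Type*} [Field F] (M : Matrix (Fin 2) (Fin 2) F) (hM : M.det ≠ 0) :
    (M⁻¹).trace ^ 2 * ((M⁻¹).det)⁻¹ - 1 = M.trace ^ 2 * (M.det)⁻¹ - 1 := by
  have hinv : M⁻¹ = (M.det)⁻¹ • M.adjugate := by
    rw [Matrix.inv_def, Ring.inverse_eq_inv']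
  rw [Matrix.det_nonsing_inv, Ring.inverse_eq_inv', inv_inv, hinv, Matrix.trace_smul,
    Matrix.adjugate_fin_two, Matrix.trace_fin_two_of, Matrix.trace_fin_two, smul_eq_mul]
  field_simp
  ring

/-! ## 2. Rank-one bookkeeping: entries of `GL₁`-valued continuous characters -/

section RankOne

variable {p : ℕ} [Fact p.Prime]

/-- `(η σ)₀₀ · (η τ)₀₀ = (η (σ τ))₀₀`. [folklore] -/
theorem entry_mul (η : FramedGaloisRep ℚ (PadicAlgCl p) 1) (σ τ : Field.absoluteGaloisGroup ℚ) :
    (η σ).val 0 0 * (η τ).val 0 0 = (η (σ * τ)).val 0 0 := by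
  rw [map_mul, Units.val_mul, Matrix.mul_apply, Fin.sum_univ_one]

/-- `(η 1)₀₀ = 1`. [folklore] -/
theorem entry_one (η : FramedGaloisRep ℚ (PadicAlgCl p) 1) :
    (η 1).val 0 0 = 1 := by
  rw [map_one, Units.val_one, Matrix.one_apply_eq]

/-- `(η (σ^n))₀₀ = ((η σ)₀₀)^n`. [folklore] -/
theorem entry_pow (η : FramedGaloisRep ℚ (PadicAlgCl p) 1) (σ : Field.absoluteGaloisGroup ℚ)
    (n : ℕ) : (η (σ ^ n)).val 0 0 = ((η σ).val 0 0) ^ n := by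
  induction n with
  | zero => rw [pow_zero, pow_zero, entry_one]
  | succ n ih => rw [pow_succ, ← entry_mul, ih, pow_succ]

/-- The entry function of a continuous `GL₁`-valued character is continuous. [folklore] -/
theorem continuous_entry (η : FramedGaloisRep ℚ (PadicAlgCl p) 1) :
    Continuous fun σ => (η σ).val 0 0 :=
  (Units.continuous_val.comp (map_continuous η)).matrix_elem 0 0

/-- **Values of a continuous character `Γ_ℚ → GL₁(ℚ̄_p)` have norm `≤ 1`** (`Γ_ℚ` is compact, so
`σ ↦ ‖η(σ)‖` is bounded, while `‖η(σⁿ)‖ = ‖η(σ)‖ⁿ`). [folklore] -/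
theorem norm_entry_le_one (η : FramedGaloisRep ℚ (PadicAlgCl p) 1)
    (σ : Field.absoluteGaloisGroup ℚ) : ‖(η σ).val 0 0‖ ≤ 1 := by
  by_contra hlt
  push Not at hlt
  have hcont : Continuous fun τ => ‖(η τ).val 0 0‖ := continuous_norm.comp (continuous_entry η)
  obtain ⟨B, hB⟩ := (isCompact_range hcont).bddAbove
  obtain ⟨n, hn⟩ := pow_unbounded_of_one_lt B hlt
  have hle : ‖(η (σ ^ n)).val 0 0‖ ≤ B := hB ⟨σ ^ n, rfl⟩
  rw [entry_pow, norm_pow] at hle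
  exact absurd (lt_of_lt_of_le hn hle) (lt_irrefl _)

/-- Hence the values have norm exactly `1`. [folklore] -/
theorem norm_entry_eq_one (η : FramedGaloisRep ℚ (PadicAlgCl p) 1)
    (σ : Field.absoluteGaloisGroup ℚ) : ‖(η σ).val 0 0‖ = 1 := by
  have h1 := norm_entry_le_one η σ
  have h2 := norm_entry_le_one η σ⁻¹
  have hprod : ‖(η σ).val 0 0‖ * ‖(η σ⁻¹).val 0 0‖ = 1 := by
    rw [← norm_mul, entry_mul, mul_inv_cancel, entry_one, norm_one]
  nlinarith [norm_nonneg ((η σ).val 0 0), norm_nonneg ((η σ⁻¹).val 0 0)]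

/-- `‖n‖ = 1` in `ℚ̄_p` for `n` prime to `p` (the norm on `PadicAlgCl p` extends the `p`-adic norm).
[folklore] -/
theorem norm_natCast_eq_one {n : ℕ} (h : p.Coprime n) : ‖(n : PadicAlgCl p)‖ = 1 := by
  have h1 : ‖((n : ℚ_[p]) : PadicAlgCl p)‖ = ‖(n : ℚ_[p])‖ := PadicAlgCl.norm_extends p _
  rw [Padic.norm_natCast_eq_one_iff.mpr h] at h1
  have h2 : ((n : ℚ_[p]) : PadicAlgCl p) = (n : PadicAlgCl p) :=
    map_natCast (algebraMap ℚ_[p] (PadicAlgCl p)) n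
  rwa [h2] at h1

end RankOne

/-! ## 3. NECESSITY of H3 (parity) and of H1 (duality): both are implied by the conclusion -/

section Necessity

variable {p : ℕ} [Fact p.Prime]

/-- **The conclusion forces residual parity**: if `ρ̄ ≅ η̄ ⊗ ad⁰ ρ̄₀` with `ρ₀` odd, then EVERY complex
conjugation `c` has `tr ρ(c) ≡ ±1 (mod 𝔪)` — because `ρ₀(c)` is an involution of determinant `-1`,
so `tr ρ₀(c) = 0`, `tr ad⁰ρ₀(c) = -1`, and `η(c) = ±1`.  No hypothesis on `p`.  Consequence: H3 cannot
be dropped from the crux (any even witness kills the H3-less statement, §4). [folklore] -/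
theorem seedConcl_forces_parity {ρ : FramedGaloisRep ℚ (PadicAlgCl p) 3} (h : SeedConcl ρ)
    {φ : ℚ →+* ℝ} {c : Field.absoluteGaloisGroup ℚ} (hc : IsComplexConjugation φ c) :
    ‖(ρ c).val.trace - 1‖ < 1 ∨ ‖(ρ c).val.trace + 1‖ < 1 := by
  obtain ⟨ρ₀, η, hodd, hcong⟩ := h
  have hc2 : c * c = 1 := by rw [← sq]; exact hc.sq_eq_one
  have hM : (ρ₀ c).val * (ρ₀ c).val = 1 := by
    rw [← Units.val_mul, ← map_mul, hc2, map_one, Units.val_one]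
  have hdet : (ρ₀ c).val.det = -1 := by
    rw [← Matrix.GeneralLinearGroup.val_det_apply, hodd φ c hc, Units.val_neg, Units.val_one]
  have htr : (ρ₀ c).val.trace = 0 := trace_eq_zero_of_mul_self_eq_one hM hdet
  have hη : (η c).val 0 0 * (η c).val 0 0 = 1 := by rw [entry_mul, hc2, entry_one]
  have hc' := hcong c
  rw [htr] at hc'
  have hsimp : (0 : PadicAlgCl p) ^ 2 * ((ρ₀ c).val.det)⁻¹ - 1 = -1 := by ring
  rw [hsimp, mul_neg, mul_one, sub_neg_eq_add] at hc'
  rcases mul_self_eq_one_iff.mp hη with h1 | h1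
  · right; rwa [h1] at hc'
  · left; rwa [h1, ← sub_eq_add_neg] at hc'

/-- The trace of an involution in `M₃(F)`, `char F = 0`, is `2r − 3` for some `r ≤ 3`
(`P = ½(1 + M)` is idempotent, of trace `r = rank P`; Mathlib `LinearMap.IsProj.trace`). [folklore] -/
theorem trace_involution_fin_three {F : Type*} [Field F] [CharZero F]
    {M : Matrix (Fin 3) (Fin 3) F} (hM : M * M = 1) :
    ∃ r : ℕ, r ≤ 3 ∧ M.trace = 2 * r - 3 := by
  set P : Matrix (Fin 3) (Fin 3) F := (2 : F)⁻¹ • (1 + M) with hP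
  have hsq : (1 + M) * (1 + M) = (2 : F) • (1 + M) := by
    have e : (1 + M) * (1 + M) = 1 + M + M + M * M := by noncomm_ring
    rw [e, hM, two_smul]; abel
  have hPP : P * P = P := by
    rw [hP, Matrix.smul_mul, Matrix.mul_smul, smul_smul, hsq, smul_smul]
    congr 1
    field_simp
  set f := Matrix.toLin' P with hf
  have hidem : IsIdempotentElem f := by
    change f * f = f
    rw [hf, Module.End.mul_eq_comp, ← Matrix.toLin'_mul, hPP]
  have htr := (LinearMap.IsIdempotentElem.isProj_range f hidem).trace
  rw [hf, Matrix.trace_toLin'_eq] at htr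
  refine ⟨Module.finrank F (LinearMap.range f), ?_, ?_⟩
  · simpa using Submodule.finrank_le (LinearMap.range f)
  · have hPt : P.trace = (2 : F)⁻¹ * (3 + M.trace) := by
      rw [hP, Matrix.trace_smul, Matrix.trace_add, Matrix.trace_one, Fintype.card_fin, smul_eq_mul]
      norm_num
    rw [hPt] at htr
    field_simp at htr
    linear_combination htr

/-- **The conclusion forces H3 VERBATIM for odd `p`**: Concl ⇒ every complex conjugation has
`tr ρ(c) = 1 ∨ tr ρ(c) = −1` exactly (an involution in `GL₃(ℚ̄_p)` has trace `∈ {±1, ±3}`, and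
`±3` is excluded by `seedConcl_forces_parity` since `‖2‖ = ‖4‖ = 1`).  So for the crux's `p ≥ 5`
the typed H3 (exact equality in characteristic `0`) is not stronger than its residual form. [folklore] -/
theorem seedConcl_forces_parity_exact (hp2 : p ≠ 2) {ρ : FramedGaloisRep ℚ (PadicAlgCl p) 3}
    (h : SeedConcl ρ) {φ : ℚ →+* ℝ} {c : Field.absoluteGaloisGroup ℚ}
    (hc : IsComplexConjugation φ c) : (ρ c).val.trace = 1 ∨ (ρ c).val.trace = -1 := by
  have hpar := seedConcl_forces_parity h hc
  have hc2 : c * c = 1 := by rw [← sq]; exact hc.sq_eq_one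
  have hM : (ρ c).val * (ρ c).val = 1 := by
    rw [← Units.val_mul, ← map_mul, hc2, map_one, Units.val_one]
  have hp2' : p.Coprime 2 := (Nat.coprime_primes Fact.out Nat.prime_two).mpr hp2
  have hp4 : p.Coprime 4 := by simpa using Nat.Coprime.mul_right hp2' hp2'
  have n2 : ‖(2 : PadicAlgCl p)‖ = 1 := by exact_mod_cast norm_natCast_eq_one hp2'
  have n4 : ‖(4 : PadicAlgCl p)‖ = 1 := by exact_mod_cast norm_natCast_eq_one hp4
  obtain ⟨r, hr, htr⟩ := trace_involution_fin_three hM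
  rw [htr] at hpar ⊢
  interval_cases r
  · exfalso; norm_num at hpar; rw [n4, n2] at hpar; simp at hpar
  · right; norm_num
  · left; norm_num
  · exfalso; norm_num at hpar; rw [n2, n4] at hpar; simp at hpar

/-- The square character `σ ↦ η(σ)² · 1 ∈ GL₁(ℚ̄_p)` of a `GL₁`-valued continuous character
(tree `FramedRep.scalar`, `FramedRep.det`). [folklore] -/
def sqChar (η : FramedGaloisRep ℚ (PadicAlgCl p) 1) : FramedGaloisRep ℚ (PadicAlgCl p) 1 :=
  (FramedRep.scalar (PadicAlgCl p) 1).comp (FramedRep.det η * FramedRep.det η)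

/-- The entry of `sqChar η` is the square of the entry of `η`. [folklore] -/
theorem sqChar_entry (η : FramedGaloisRep ℚ (PadicAlgCl p) 1) (σ : Field.absoluteGaloisGroup ℚ) :
    (sqChar η σ).val 0 0 = ((η σ).val 0 0) ^ 2 := by
  show (algebraMap (PadicAlgCl p) (Matrix (Fin 1) (Fin 1) (PadicAlgCl p))
    (((FramedRep.det η * FramedRep.det η) σ : (PadicAlgCl p)ˣ) : PadicAlgCl p)) 0 0 = _
  rw [Matrix.algebraMap_matrix_apply, if_pos rfl, ContinuousMonoidHom.mul_apply, Units.val_mul,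
    FramedRep.det_apply, Matrix.GeneralLinearGroup.val_det_apply, Matrix.det_fin_one, sq]
  rfl

/-- **The conclusion forces H1** (residual essential self-duality, with `ν = η²`): `ad⁰` is
self-dual, so `tr ρ(σ⁻¹) ≡ η(σ⁻¹) tr ad⁰ρ₀(σ) (mod 𝔪)` and `tr ρ(σ) ≡ η(σ)² · tr ρ(σ⁻¹)`.  Uses only
`‖η(σ)‖ = 1` (compactness of `Γ_ℚ`) and the ultrametric inequality; no hypothesis on `p`.
Consequence: H1 cannot be dropped from the crux (any residually non-essentially-self-dual witness
kills the H1-less statement, §4). [folklore] -/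
theorem seedConcl_forces_duality {ρ : FramedGaloisRep ℚ (PadicAlgCl p) 3} (h : SeedConcl ρ) :
    DualityHyp ρ := by
  obtain ⟨ρ₀, η, -, hcong⟩ := h
  refine ⟨sqChar η, fun σ => ?_⟩
  rw [sqChar_entry]
  have hA' : (ρ₀ σ⁻¹).val.trace ^ 2 * ((ρ₀ σ⁻¹).val.det)⁻¹ - 1 =
      (ρ₀ σ).val.trace ^ 2 * ((ρ₀ σ).val.det)⁻¹ - 1 := by
    rw [map_inv, Matrix.coe_units_inv]
    exact adTrace_inv _ (Matrix.GeneralLinearGroup.det_ne_zero _)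
  have hee' : (η σ).val 0 0 * (η σ⁻¹).val 0 0 = 1 := by rw [entry_mul, mul_inv_cancel, entry_one]
  have h1 := hcong σ
  have h2 := hcong σ⁻¹
  rw [hA'] at h2
  set e := (η σ).val 0 0
  set e' := (η σ⁻¹).val 0 0
  set t := (ρ σ).val.trace
  set t' := (ρ σ⁻¹).val.trace
  set A := (ρ₀ σ).val.trace ^ 2 * ((ρ₀ σ).val.det)⁻¹ - 1
  have key : t - e ^ 2 * t' = (t - e * A) + -(e ^ 2 * (t' - e' * A)) := by
    linear_combination (-(e * A)) * hee'
  rw [key]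
  calc ‖(t - e * A) + -(e ^ 2 * (t' - e' * A))‖
      ≤ max ‖t - e * A‖ ‖-(e ^ 2 * (t' - e' * A))‖ := IsUltrametricDist.norm_add_le_max _ _
    _ < 1 := by
      refine max_lt h1 ?_
      rw [norm_neg, norm_mul, norm_pow, norm_entry_eq_one, one_pow, one_mul]
      exact h2

end Necessity

/-! ## 4. Load-bearing hypotheses: the H-less cruxes are false as soon as the obvious witnesses exist

The witnesses are genuine Galois representations with non-abelian image; the tree cannot yet
CONSTRUCT any of them (no Galois group of a specific non-abelian number field is computed in
Mathlib), so they enter as precise `Prop`s (`EvenWitness`, `NonSelfDualWitness`) and the kills are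
kernel-checked IMPLICATIONS (negative lemmas modulo H, D-0016 step 7). -/

section LoadBearing

/-- The crux WITHOUT H3 (parity). [folklore] -/
def WithoutParity : Prop :=
  ∀ (p : ℕ) [Fact p.Prime], 5 ≤ p → ∀ ρ : FramedGaloisRep ℚ (PadicAlgCl p) 3,
    DualityHyp ρ → IrredHyp ρ → SeedConcl ρ

/-- The crux WITHOUT H1 (residual essential self-duality). [folklore] -/
def WithoutDuality : Prop :=
  ∀ (p : ℕ) [Fact p.Prime], 5 ≤ p → ∀ ρ : FramedGaloisRep ℚ (PadicAlgCl p) 3,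
    IrredHyp ρ → ParityHyp ρ → SeedConcl ρ

/-- **H_even — an EVEN witness.**  Some `p ≥ 5` and some `ρ : Γ_ℚ → GL₃(ℚ̄_p)` satisfying H1 and H2
on which a complex conjugation acts TRIVIALLY (`ρ(c) = 1`, trace `3`).  Paper instances (not
constructible in the tree today): (i) the rotation representation `Gal(M/ℚ) ≅ S₄ ↪ SO₃(ℤ) ⊂ GL₃(ℚ̄_p)`
of the cube for a totally real `S₄`-quartic field `M` (e.g. the quartic field of discriminant
`1957`), any `p ≥ 5`: orthogonal (`ν = 1`), image of `Γ_{ℚ(ζ_p)}` contains `A₄`, whose `3`-dimensional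
representation stays absolutely irreducible in characteristic `p ∤ 12`; (ii) `ad⁰` of an even
icosahedral representation (tree `DoudMooreEvenIcosahedral`).
[cite: SerreDurham1977, §6.1] [folklore] -/
def EvenWitness : Prop :=
  ∃ (p : ℕ) (_ : Fact p.Prime), 5 ≤ p ∧ ∃ ρ : FramedGaloisRep ℚ (PadicAlgCl p) 3,
    DualityHyp ρ ∧ IrredHyp ρ ∧
    ∃ (φ : ℚ →+* ℝ) (c : Field.absoluteGaloisGroup ℚ), IsComplexConjugation φ c ∧ ρ c = 1

/-- **H_nsd — a residually NON-essentially-self-dual witness.**  Some `p ≥ 5` and some `ρ` with H2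
and H3 but not H1.  Paper instance: the `3`-dimensional Artin representation of a
`PSL₂(𝔽₇)`-extension of `ℚ` (Trinks' `x⁷ − 7x + 3`, three real roots, so `c ↦` an involution, of
trace `−1` in the `3`-dimensional representation: H3 holds), at any prime `p ∤ 2·7·disc`: the image
`PSL₂(𝔽₇)` is simple, so `ρ̄|Γ_{ℚ(ζ_p)}` is still absolutely irreducible (H2), a twisting character
`ν̄` would have to factor through `PSL₂(𝔽₇)`, hence be trivial, and the character values
`(−1 ± √−7)/2` on elements of order `7` are not real, so `ρ̄ ≇ ρ̄^∨` for `p ≠ 7` (¬H1).  (At `p = 7`,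
the conjugation-RAMIFIED prime of the coefficient field `ℚ(√−7)`, the same representation IS
residually self-dual, `PSL₂(𝔽₇) ↪ SO₃(𝔽₇) = ad⁰`: the route's lever in miniature.) [folklore] -/
def NonSelfDualWitness : Prop :=
  ∃ (p : ℕ) (_ : Fact p.Prime), 5 ≤ p ∧ ∃ ρ : FramedGaloisRep ℚ (PadicAlgCl p) 3,
    IrredHyp ρ ∧ ParityHyp ρ ∧ ¬ DualityHyp ρ

variable {p : ℕ} [Fact p.Prime]

/-- For odd `p`, an element `g ∈ GL₃(ℚ̄_p)` equal to `1` has trace `3`, and `‖3 ∓ 1‖ = ‖2‖, ‖4‖ = 1`: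
the residual parity conclusion of `seedConcl_forces_parity` FAILS at such a `c`. [folklore] -/
theorem not_residualParity_of_apply_eq_one (hp2 : p ≠ 2) {ρ : FramedGaloisRep ℚ (PadicAlgCl p) 3}
    {c : Field.absoluteGaloisGroup ℚ} (h : ρ c = 1) :
    ¬ (‖(ρ c).val.trace - 1‖ < 1 ∨ ‖(ρ c).val.trace + 1‖ < 1) := by
  have hc2 : p.Coprime 2 := (Nat.coprime_primes Fact.out Nat.prime_two).mpr hp2
  have hc4 : p.Coprime 4 := by simpa using Nat.Coprime.mul_right hc2 hc2
  have htr : (ρ c).val.trace = 3 := by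
    rw [h, Units.val_one, Matrix.trace_one, Fintype.card_fin, Nat.cast_ofNat]
  rw [htr, show (3 : PadicAlgCl p) - 1 = (2 : ℕ) by norm_num,
    show (3 : PadicAlgCl p) + 1 = (4 : ℕ) by norm_num, norm_natCast_eq_one hc2,
    norm_natCast_eq_one hc4]
  simp

/-- **H3 is load-bearing**: given an even witness, the parity-less crux is FALSE
(`seedConcl_forces_parity` at the trivially-acting complex conjugation).  Negative lemma modulo
`EvenWitness`. [folklore] -/
theorem withoutParity_false_of_evenWitness : EvenWitness → ¬ WithoutParity := by
  rintro ⟨p, hp, h5, ρ, hdual, hirr, φ, c, hc, h1⟩ hW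
  have hp2 : p ≠ 2 := by omega
  exact not_residualParity_of_apply_eq_one hp2 h1
    (seedConcl_forces_parity (hW p h5 ρ hdual hirr) hc)

/-- **H1 is load-bearing**: given a residually non-essentially-self-dual witness, the duality-less
crux is FALSE (`seedConcl_forces_duality`).  Negative lemma modulo `NonSelfDualWitness`. [folklore] -/
theorem withoutDuality_false_of_nonSelfDualWitness : NonSelfDualWitness → ¬ WithoutDuality := by
  rintro ⟨p, hp, h5, ρ, hirr, hpar, hndual⟩ hW
  exact hndual (seedConcl_forces_duality (hW p h5 ρ hirr hpar))

end LoadBearing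

/-! ## 4b. A natural VARIANT of the conclusion is refuted: the seed cannot be EVEN

The parity of the seed is not a free choice: under H3, NO even `ρ₀` (i.e. `det ρ₀(c) = +1` at the
trace-`±1` complex conjugation) can satisfy the congruence, because an even involution in `GL₂` has
`tr²/det − 1 = 3` and `‖±1 ∓ 3‖ = ‖2‖, ‖4‖ = 1` for `p ≠ 2`.  (So "odd" in the conclusion is forced
by H3, exactly as H3 is forced by "odd": `seedConcl_forces_parity`.) -/

section NoEvenSeed

variable {p : ℕ} [Fact p.Prime]

/-- An involution of determinant `+1` in `M₂(F)` has `tr² = 4`, hence adjoint trace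
`tr²/det − 1 = 3`. [folklore] -/
theorem adTrace_eq_three_of_mul_self_eq_one {F : Type*} [Field F] {M : Matrix (Fin 2) (Fin 2) F}
    (hM : M * M = 1) (hdet : M.det = 1) : M.trace ^ 2 * (M.det)⁻¹ - 1 = 3 := by
  have h00 : (M * M) 0 0 = (1 : Matrix (Fin 2) (Fin 2) F) 0 0 := by rw [hM]
  have h11 : (M * M) 1 1 = (1 : Matrix (Fin 2) (Fin 2) F) 1 1 := by rw [hM]
  simp only [Matrix.mul_apply, Fin.sum_univ_two, Matrix.one_apply_eq] at h00 h11
  rw [hdet, inv_one, mul_one, Matrix.trace_fin_two]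
  rw [Matrix.det_fin_two] at hdet
  linear_combination h00 + h11 + 2 * hdet

/-- **No EVEN seed under H3.**  For `p ≠ 2`: if some complex conjugation `c` has `tr ρ(c) = ±1`,
then there are NO `ρ₀`, `η` with `det ρ₀(c) = 1` and the adjoint congruence — the variant of the
conclusion with an even seed is refuted outright (at `σ = c` the congruence would read
`‖±1 ∓ 3‖ < 1`). [folklore] -/
theorem no_even_seed (hp2 : p ≠ 2) {ρ : FramedGaloisRep ℚ (PadicAlgCl p) 3}
    {φ : ℚ →+* ℝ} {c : Field.absoluteGaloisGroup ℚ} (hc : IsComplexConjugation φ c)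
    (htr : (ρ c).val.trace = 1 ∨ (ρ c).val.trace = -1) :
    ¬ ∃ (ρ₀ : FramedGaloisRep ℚ (PadicAlgCl p) 2) (η : FramedGaloisRep ℚ (PadicAlgCl p) 1),
      Matrix.GeneralLinearGroup.det (ρ₀ c) = 1 ∧ ∀ σ, ‖(ρ σ).val.trace -
        (η σ).val 0 0 * ((ρ₀ σ).val.trace ^ 2 * ((ρ₀ σ).val.det)⁻¹ - 1)‖ < 1 := by
  rintro ⟨ρ₀, η, heven, hcong⟩
  have hc2 : c * c = 1 := by rw [← sq]; exact hc.sq_eq_one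
  have hM : (ρ₀ c).val * (ρ₀ c).val = 1 := by
    rw [← Units.val_mul, ← map_mul, hc2, map_one, Units.val_one]
  have hdet : (ρ₀ c).val.det = 1 := by
    rw [← Matrix.GeneralLinearGroup.val_det_apply, heven, Units.val_one]
  have h3 : (ρ₀ c).val.trace ^ 2 * ((ρ₀ c).val.det)⁻¹ - 1 = 3 :=
    adTrace_eq_three_of_mul_self_eq_one hM hdet
  have hη : (η c).val 0 0 * (η c).val 0 0 = 1 := by rw [entry_mul, hc2, entry_one]
  have hp2' : p.Coprime 2 := (Nat.coprime_primes Fact.out Nat.prime_two).mpr hp2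
  have hp4 : p.Coprime 4 := by simpa using Nat.Coprime.mul_right hp2' hp2'
  have n2 : ‖(2 : PadicAlgCl p)‖ = 1 := by exact_mod_cast norm_natCast_eq_one hp2'
  have n4 : ‖(4 : PadicAlgCl p)‖ = 1 := by exact_mod_cast norm_natCast_eq_one hp4
  have hc' := hcong c
  rw [h3] at hc'
  rcases mul_self_eq_one_iff.mp hη with h1 | h1 <;> rcases htr with h2 | h2 <;>
    rw [h1, h2] at hc' <;> norm_num at hc' <;> linarith

end NoEvenSeed

/-! ## 5. Targets — the lead's stubs (line `birth`, 7 stubs), audited as typed; nothing to kill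

* A `stub_residualDualReduction` (no `5 ≤ p`!): true for every `p` — integral model over the open
  valuation ring `ℤ̄_p` (compact image lies in `GL₃(L)`, `L/ℚ_p` finite, by Baire), open-kernel
  reduction, abs-irreducibility transported from `Γ_{ℚ(ζ_p)}` by Brauer–Nesbitt on the common
  restriction, `ν̄ :=` reduction of the unit-norm `ν` (`norm_entry_eq_one`).
* B `stub_symmetricSimilitudeForm`: true — Newton with `2, 3 ∈ kˣ`, `brauerNesbitt_holds`, Schur,
  `det(−A) = −det A`.
* C `stub_adSurjectiveOfSplitForm`: true — conventions consistent (see docblock); `Ad : PGL₂ → SO₃`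
  is bijective on `k`-points for `k` algebraically closed, `char ≠ 2`.
* D `stub_twistedAdjointOfGO3`: true given `hAd`; `ker ν̄ ⊇ ker ρ̄` because `A ≠ 0`.
* E `stub_oddOfConjugationTrace`: true — this file's `trace_eq_zero_of_mul_self_eq_one` is the
  `det = −1` half of the same Cayley–Hamilton dichotomy (`det = +1` ⇒ scalar).
* F `stub_seedOfExactOddLift`: true; only `p ≠ 2` is used (`1 ≢ −1`).
* G `stub_exactOddLift`: true CONDITIONALLY on Khare–Wintenberger when `p ∣ |im τ̄|`; fact-free on
  the `p′`-branch.  This is the crux's entire non-elementary content.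
-/

end Summit.Langlands.Langlands.Cruxes.AdjointSeedFromDuality.Disproof
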